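import Literature.AlgebraicGeometry.HodgeTheory.QuaternionicQuarticDoublePlaneCoordinates
import Literature.AlgebraicGeometry.HodgeTheory.QuaternionicQuarticDoublePlaneBirational
import HarnessLib

/-!
# The double plane `t² = s·α·ψ` is a free rank-2 algebra over the `(s, y)`-plane; hence `h̄` is a non-zero-divisor,
# the double-plane chart ring is a domain and the deck chart is birational to it

Layer `Literature/AlgebraicGeometry/HodgeTheory`. Definitions (the two-variable forms `planeU₀₂ planeU₁₂ planeΨ₂ planeA₂
planeG₂ planeH₂`, the monic quadratic `planeF = T² − G`, the re-indexing `toPolyEquiv : R[s,y,t] ≃ₐ[R] R[s,y][T]` and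
`planeDoubleRingEquivAdjoinRoot`) + proved API; no named fact. Sequel of `QuaternionicQuarticDoublePlaneCoordinates`
(`doublePlaneRingEquivPlane : DoublePlaneRing a ≃ₐ[R] R[s,y,t]/(F)`) and `QuaternionicQuarticDoublePlaneBirational`
(`birationalOver_spec_toDeck_of_mem_nonZeroDivisors`). Written by the prover seat `leafhand-hodge-q8symplecticpowers-4` (g4,
cell `pub-hsemireg`) for route `HodgeConjecture/Q8SymplecticPowers` (crux K1Q, stmt-HodgeConjecture-24190), brick **Zb-3/S1a** of
the S1 programme (`stub_regularVeryGeneralQ`).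

* `toPolyEquiv` — `R[s, y, t] ≃ₐ[R] (R[s, y])[T]`, `s ↦ C s`, `y ↦ C y`, `t ↦ T` (Mathlib `renameEquiv (finRotate 3)` then
  `finSuccEquiv`); `toPolyEquiv_planeRel : F ↦ planeF = T² − C G₂` with `G₂ = s·A₂·Ψ₂ ∈ R[s, y]`
  (`A₂ = u₀(s,y) − u₁(s,y) = dinv·(a₀ + a₁)·y·(s² − 1)`, `Ψ₂ = ψ(u(s,y), 1)`);
* **`planeDoubleRingEquivAdjoinRoot : PlaneDoubleRing a dinv ≃ₐ[R] AdjoinRoot planeF`** — Zariski's double plane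
  `z² = f(x, y)` IS `R[s, y][T]/(T² − G₂)`, a FREE `R[s, y]`-module on `1, T` (`AdjoinRoot.powerBasis'`, `planeF_monic`);
* `of_mem_nonZeroDivisors_adjoinRoot` — over a domain `R`, every non-zero `H ∈ R[s, y]` is a non-zero-divisor of the double
  plane (torsion-freeness of a free module);
* **`hBar_mem_nonZeroDivisors`** — `h̄ = [c·σc·α·ψ] ↦ of (planeH₂)`, `planeH₂ = s²y·y·A₂·Ψ₂`; so for `R` a domain,
  `(a₀² − a₁²)·dinv = 1` and `planeH₂ ≠ 0` (⟸ `a₀ + a₁ ≠ 0`, `dinv ≠ 0`, `Ψ₂ ≠ 0`: `planeH₂_ne_zero`), `h̄` is a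
  non-zero-divisor of `DoublePlaneRing a`; hence (`isDomain_doublePlaneRing`) the double-plane chart ring is a DOMAIN as soon
  as the deck ring is, and (`birationalOver_spec_doublePlane`) `Spec (DeckRing a)` and `Spec (DoublePlaneRing a)` are
  birational over `Spec R` — with `QuaternionicQuarticDeckChartBirational`, every model of `V_(c,ψ)` at such a parameter is
  birational to the double plane.

Residue (S-sized, recorded): `Ψ₂ ≠ 0` ⟸ `ψ ≠ 0`, by injectivity of `R[u₀, u₁] → R[s, y]`, `u ↦ u(s, y)` (monomials
`c'ⁱ y'ʲ ↦ s²ⁱ yⁱ⁺ʲ` are distinct). Honest scope: explicit commutative algebra; nothing here bears on HC; S1 ∕ K1Q NOT proved.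

## References

* [Zariski1929] O. Zariski, On the linear connection index of the algebraic surfaces zⁿ = f(x, y), PNAS 15 (1929).
* [Naie2007] D. Naie, The irregularity of cyclic multiple planes after Zariski, Enseign. Math. 53 (2007), §1.1–§1.2
  (standard cyclic coverings `Spec (⊕ L^{-i})` — free of rank `n` over the base — and the normalization procedure).
* [AtiyahMacdonald1969] M. F. Atiyah, I. G. Macdonald, Introduction to Commutative Algebra (1969), Prop. 3.9, Ex. 3.7.
* [GortzWedhorn2020] U. Görtz, T. Wedhorn, Algebraic Geometry I, 2nd ed. (2020), Prop. 4.32 (2).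
-/

noncomputable section

open MvPolynomial CategoryTheory AlgebraicGeometry

namespace Literature.AlgebraicGeometry.HodgeTheory.Q8Family

universe v

/-! ### Re-indexing `R[s, y, t] ≃ (R[s, y])[T]` -/

section PolyEquiv

variable {R : Type v} [CommRing R]

/-- `R[s, y, t] ≃ₐ[R] (R[s, y])[T]`: `s = X 0 ↦ C (X 0)`, `y = X 1 ↦ C (X 1)`, `t = X 2 ↦ T`.
[cite: AtiyahMacdonald1969, Ch. 1 Ex. 2–4 (polynomial rings in several variables)] -/
def toPolyEquiv (R : Type v) [CommRing R] : MvPolynomial (Fin 3) R ≃ₐ[R] Polynomial (MvPolynomial (Fin 2) R) :=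
  (renameEquiv R (finRotate 3)).trans (finSuccEquiv R 2)

/-- `toPolyEquiv s = C s`. [cite: AtiyahMacdonald1969, Ch. 1 Ex. 2–4 (polynomial rings in several variables)] -/
@[simp] theorem toPolyEquiv_X0 : toPolyEquiv R (X 0) = Polynomial.C (X 0) := by
  have h : (finRotate 3) (0 : Fin 3) = Fin.succ 0 := by decide
  rw [toPolyEquiv, AlgEquiv.trans_apply, renameEquiv_apply, rename_X, h, finSuccEquiv_X_succ]

/-- `toPolyEquiv y = C y`. [cite: AtiyahMacdonald1969, Ch. 1 Ex. 2–4 (polynomial rings in several variables)] -/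
@[simp] theorem toPolyEquiv_X1 : toPolyEquiv R (X 1) = Polynomial.C (X 1) := by
  have h : (finRotate 3) (1 : Fin 3) = Fin.succ 1 := by decide
  rw [toPolyEquiv, AlgEquiv.trans_apply, renameEquiv_apply, rename_X, h, finSuccEquiv_X_succ]

/-- `toPolyEquiv t = T`. [cite: AtiyahMacdonald1969, Ch. 1 Ex. 2–4 (polynomial rings in several variables)] -/
@[simp] theorem toPolyEquiv_X2 : toPolyEquiv R (X 2) = Polynomial.X := by
  have h : (finRotate 3) (2 : Fin 3) = 0 := by decide
  rw [toPolyEquiv, AlgEquiv.trans_apply, renameEquiv_apply, rename_X, h, finSuccEquiv_X_zero]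

/-- `toPolyEquiv` on constants. [cite: AtiyahMacdonald1969, Ch. 1 Ex. 2–4 (polynomial rings in several variables)] -/
@[simp] theorem toPolyEquiv_C (r : R) : toPolyEquiv R (C r) = Polynomial.C (C r) := by
  rw [← MvPolynomial.algebraMap_eq, AlgEquiv.commutes, Polynomial.algebraMap_apply, MvPolynomial.algebraMap_eq]

end PolyEquiv

/-! ### The two-variable forms and the monic quadratic -/

section TwoVariables

variable {R : Type v} [CommRing R] {e : ℕ} (a : CIdx e → R) (dinv : R)

/-- `u₀(s, y)` in `R[s, y]`. [cite: Naie2007, §1.2 (normalization procedure) and Example 1] -/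
def planeU₀₂ : MvPolynomial (Fin 2) R :=
  C dinv * (C (coefLin a 0) * (X 0 ^ 2 * X 1 - C (coefLin a 2)) - C (coefLin a 1) * (X 1 - C (coefLin a 2)))

/-- `u₁(s, y)` in `R[s, y]`. [cite: Naie2007, §1.2 (normalization procedure) and Example 1] -/
def planeU₁₂ : MvPolynomial (Fin 2) R :=
  C dinv * (C (coefLin a 0) * (X 1 - C (coefLin a 2)) - C (coefLin a 1) * (X 0 ^ 2 * X 1 - C (coefLin a 2)))

/-- `Ψ₂ = ψ(u₀(s,y), u₁(s,y), 1)` in `R[s, y]`. [cite: Naie2007, §1.2 (normalization procedure) and Example 1] -/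
def planeΨ₂ : MvPolynomial (Fin 2) R := aeval ![planeU₀₂ a dinv, planeU₁₂ a dinv, 1] (ψOfR a)

/-- `A₂ = α(u(s,y)) = u₀(s,y) − u₁(s,y)`. [cite: Naie2007, §1.2 (normalization procedure) and Example 1] -/
def planeA₂ : MvPolynomial (Fin 2) R := planeU₀₂ a dinv - planeU₁₂ a dinv

/-- `A₂ = dinv·(a₀ + a₁)·(s²y − y)`: the branch line `α = 0` is `y·(s² − 1) = 0` in the plane.
[cite: Naie2007, §1.2 (normalization procedure) and Example 1] -/
theorem planeA₂_eq : planeA₂ a dinv = C dinv * C (coefLin a 0 + coefLin a 1) * (X 0 ^ 2 * X 1 - X 1) := by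
  simp only [planeA₂, planeU₀₂, planeU₁₂, map_add]
  ring

/-- `G₂ = s·A₂·Ψ₂`, the branch form of the double plane over the `(s, y)`-plane. [cite: Zariski1929] -/
def planeG₂ : MvPolynomial (Fin 2) R := X 0 * planeA₂ a dinv * planeΨ₂ a dinv

/-- `H₂ = s²y·y·A₂·Ψ₂`, the image of `h = c·σc·α·ψ` in `R[s, y]`. [cite: Naie2007, §1.2 (normalization procedure) and Example 1] -/
def planeH₂ : MvPolynomial (Fin 2) R := X 0 ^ 2 * X 1 * X 1 * planeA₂ a dinv * planeΨ₂ a dinv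

/-- The monic quadratic `planeF = T² − G₂ ∈ (R[s, y])[T]` — Zariski's `z² = f(x, y)`. [cite: Zariski1929] -/
def planeF : Polynomial (MvPolynomial (Fin 2) R) := Polynomial.X ^ 2 - Polynomial.C (planeG₂ a dinv)

/-- `planeF` is monic. [cite: Zariski1929] -/
theorem planeF_monic : (planeF a dinv).Monic := Polynomial.monic_X_pow_sub_C _ two_ne_zero

/-- `toPolyEquiv u₀(s,y) = C u₀₂`. [cite: Naie2007, §1.2 (normalization procedure) and Example 1] -/
theorem toPolyEquiv_planeU₀ : toPolyEquiv R (planeU₀ a dinv) = Polynomial.C (planeU₀₂ a dinv) := by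
  simp only [planeU₀, planeU₀₂, map_mul, map_sub, map_pow, toPolyEquiv_C, toPolyEquiv_X0, toPolyEquiv_X1]

/-- `toPolyEquiv u₁(s,y) = C u₁₂`. [cite: Naie2007, §1.2 (normalization procedure) and Example 1] -/
theorem toPolyEquiv_planeU₁ : toPolyEquiv R (planeU₁ a dinv) = Polynomial.C (planeU₁₂ a dinv) := by
  simp only [planeU₁, planeU₁₂, map_mul, map_sub, map_pow, toPolyEquiv_C, toPolyEquiv_X0, toPolyEquiv_X1]

/-- `toPolyEquiv (ψ₄ ∘ planeSubst) = C Ψ₂`. [cite: Naie2007, §1.2 (normalization procedure) and Example 1] -/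
theorem toPolyEquiv_planeSubst_ψ₄ :
    toPolyEquiv R (planeSubst a dinv (ψ₄ a)) = Polynomial.C (planeΨ₂ a dinv) := by
  have key : ((toPolyEquiv R).toAlgHom.comp ((planeSubst a dinv).comp dehom₄)) =
      (IsScalarTower.toAlgHom R (MvPolynomial (Fin 2) R) (Polynomial (MvPolynomial (Fin 2) R))).comp
        (aeval ![planeU₀₂ a dinv, planeU₁₂ a dinv, 1]) := by
    refine MvPolynomial.algHom_ext fun i => ?_
    fin_cases i
    · simp [dehom₄, toPolyEquiv_planeU₀]
    · simp [dehom₄, toPolyEquiv_planeU₁]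
    · simp [dehom₄]
  have h := congrArg (fun φ => φ (ψOfR a)) key
  simpa [ψ₄, planeΨ₂, Polynomial.algebraMap_apply] using h

/-- `toPolyEquiv (α₄ ∘ planeSubst) = C A₂`. [cite: Naie2007, §1.2 (normalization procedure) and Example 1] -/
theorem toPolyEquiv_planeSubst_α₄ : toPolyEquiv R (planeSubst a dinv α₄) = Polynomial.C (planeA₂ a dinv) := by
  simp only [α₄, map_sub, planeSubst_X0, planeSubst_X1, toPolyEquiv_planeU₀, toPolyEquiv_planeU₁, planeA₂]

/-- **`toPolyEquiv F = T² − C G₂`.** [cite: Zariski1929] -/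
theorem toPolyEquiv_planeRel : toPolyEquiv R (planeRel a dinv) = planeF a dinv := by
  rw [planeRel]
  simp only [dpRel, map_sub, map_pow, map_mul, planeSubst_X3, planeSubst_X2, toPolyEquiv_X2, toPolyEquiv_X0,
    toPolyEquiv_planeSubst_α₄, toPolyEquiv_planeSubst_ψ₄, planeF, planeG₂]

/-- `toPolyEquiv (h₄ ∘ planeSubst) = C H₂` (needs `(a₀² − a₁²)·dinv = 1` for `c(u(s,y)) = s²y`, `σc(u(s,y)) = y`).
[cite: Naie2007, §1.2 (normalization procedure) and Example 1] -/
theorem toPolyEquiv_planeSubst_h₄ (hd : (coefLin a 0 ^ 2 - coefLin a 1 ^ 2) * dinv = 1) :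
    toPolyEquiv R (planeSubst a dinv (h₄ a)) = Polynomial.C (planeH₂ a dinv) := by
  simp only [h₄, map_mul, planeSubst_c₄ a dinv hd, planeSubst_c₄' a dinv hd, map_pow, toPolyEquiv_X0, toPolyEquiv_X1,
    toPolyEquiv_planeSubst_α₄, toPolyEquiv_planeSubst_ψ₄, planeH₂]

end TwoVariables

/-! ### The double plane is `AdjoinRoot (T² − G₂)`, free over `R[s, y]` -/

section Free

variable {R : Type v} [CommRing R] {e : ℕ} (a : CIdx e → R) (dinv : R)

/-- `(F) ↦ (T² − C G₂)` under `toPolyEquiv`. [cite: Zariski1929] -/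
theorem span_planeF_eq_map :
    Ideal.span {planeF a dinv} =
      (Ideal.span {planeRel a dinv}).map (toPolyEquiv R : MvPolynomial (Fin 3) R →+* Polynomial (MvPolynomial (Fin 2) R)) := by
  rw [Ideal.map_span, Set.image_singleton]
  congr 2
  exact (toPolyEquiv_planeRel a dinv).symm

/-- **The double-plane chart is `AdjoinRoot (T² − G₂)`** over `R[s, y]`. [cite: Zariski1929]
[cite: Naie2007, §1.1 (standard cyclic coverings) and §1.2] -/
def planeDoubleRingEquivAdjoinRoot : PlaneDoubleRing a dinv ≃ₐ[R] AdjoinRoot (planeF a dinv) :=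
  Ideal.quotientEquivAlg (Ideal.span {planeRel a dinv}) (Ideal.span {planeF a dinv}) (toPolyEquiv R)
    (span_planeF_eq_map a dinv)

/-- The equivalence on classes: `[p] ↦ mk (toPolyEquiv p)`. [cite: Zariski1929] -/
@[simp] theorem planeDoubleRingEquivAdjoinRoot_mk (p : MvPolynomial (Fin 3) R) :
    planeDoubleRingEquivAdjoinRoot a dinv (Ideal.Quotient.mk (Ideal.span {planeRel a dinv}) p) =
      AdjoinRoot.mk (planeF a dinv) (toPolyEquiv R p) := rfl

/-- **A non-zero function on the plane is a non-zero-divisor of the double plane** (`R` a domain): `AdjoinRoot planeF` is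
free over the domain `R[s, y]` (basis `1, T`), hence torsion-free. [cite: Naie2007, §1.1 (standard cyclic coverings) and §1.2]
[cite: AtiyahMacdonald1969, Prop. 3.9 and Ex. 3.7] -/
theorem of_mem_nonZeroDivisors_adjoinRoot [IsDomain R] {H : MvPolynomial (Fin 2) R} (hH : H ≠ 0) :
    AdjoinRoot.of (planeF a dinv) H ∈ nonZeroDivisors (AdjoinRoot (planeF a dinv)) := by
  haveI : Module.Free (MvPolynomial (Fin 2) R) (AdjoinRoot (planeF a dinv)) :=
    Module.Free.of_basis (AdjoinRoot.powerBasis' (planeF_monic a dinv)).basis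
  refine mem_nonZeroDivisors_iff_right.mpr fun x hx => ?_
  have h1 : H • x = 0 := by rw [Algebra.smul_def, mul_comm]; exact hx
  exact ((IsRegular.of_ne_zero hH).isSMulRegular (M := AdjoinRoot (planeF a dinv))).right_eq_zero_of_smul h1

end Free

/-! ### `h̄` is a non-zero-divisor; the chart ring is a domain; birationality -/

section NonZeroDivisor

variable {R : Type v} [CommRing R] {e : ℕ} (a : CIdx e → R) (dinv : R)
  (hd : (coefLin a 0 ^ 2 - coefLin a 1 ^ 2) * dinv = 1)
include hd

/-- Under the composite `DoublePlaneRing a ≃ R[s,y,t]/(F) ≃ AdjoinRoot planeF`, `h̄ ↦ of H₂`.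
[cite: Naie2007, §1.2 (normalization procedure) and Example 1] -/
theorem equiv_hBar :
    ((doublePlaneRingEquivPlane a dinv hd).trans (planeDoubleRingEquivAdjoinRoot a dinv)) (hBar a) =
      AdjoinRoot.of (planeF a dinv) (planeH₂ a dinv) := by
  rw [AlgEquiv.trans_apply, hBar, doublePlaneRingEquivPlane_mk, planeDoubleRingEquivAdjoinRoot_mk,
    toPolyEquiv_planeSubst_h₄ a dinv hd, AdjoinRoot.mk_C]

/-- **`h̄ = [c·σc·α·ψ]` is a non-zero-divisor of the double-plane chart ring** (`R` a domain, `(a₀² − a₁²)dinv = 1`,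
`H₂ ≠ 0`). [cite: Naie2007, §1.2 (normalization procedure) and Example 1] [cite: AtiyahMacdonald1969, Prop. 3.9 and Ex. 3.7] -/
theorem hBar_mem_nonZeroDivisors [IsDomain R] (hH : planeH₂ a dinv ≠ 0) :
    hBar a ∈ nonZeroDivisors (DoublePlaneRing a) := by
  set Θ := (doublePlaneRingEquivPlane a dinv hd).trans (planeDoubleRingEquivAdjoinRoot a dinv) with hΘdef
  have hΘ := equiv_hBar a dinv hd
  refine mem_nonZeroDivisors_iff_right.mpr fun x hx => ?_
  have h1 : Θ x * Θ (hBar a) = 0 := by rw [← map_mul, hx, map_zero]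
  rw [hΘ] at h1
  have h2 : Θ x = 0 :=
    (mem_nonZeroDivisors_iff_right.mp (of_mem_nonZeroDivisors_adjoinRoot a dinv hH)) _ h1
  exact Θ.injective (by rw [h2, map_zero])

omit hd in
/-- `H₂ ≠ 0` from `dinv ≠ 0`, `a₀ + a₁ ≠ 0` and `Ψ₂ ≠ 0` (`R` a domain). [cite: Naie2007, §1.2 (normalization procedure) and Example 1] -/
theorem planeH₂_ne_zero [IsDomain R] (hdinv : dinv ≠ 0) (h01 : coefLin a 0 + coefLin a 1 ≠ 0)
    (hΨ : planeΨ₂ a dinv ≠ 0) : planeH₂ a dinv ≠ 0 := by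
  have hX0 : (X 0 : MvPolynomial (Fin 2) R) ≠ 0 := X_ne_zero _
  have hX1 : (X 1 : MvPolynomial (Fin 2) R) ≠ 0 := X_ne_zero _
  have hq : (X 0 ^ 2 * X 1 - X 1 : MvPolynomial (Fin 2) R) ≠ 0 := by
    intro h
    have h' := congrArg (eval ![(0 : R), 1]) h
    simp at h'
  have hA : planeA₂ a dinv ≠ 0 := by
    rw [planeA₂_eq]
    exact mul_ne_zero (mul_ne_zero (C_ne_zero.mpr hdinv) (C_ne_zero.mpr h01)) hq
  simp only [planeH₂]
  exact mul_ne_zero (mul_ne_zero (mul_ne_zero (mul_ne_zero (pow_ne_zero _ hX0) hX1) hX1) hA) hΨ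

/-- **The double-plane chart ring is a domain** when the deck ring is, `R` is a domain, `(a₀² − a₁²)dinv = 1` and
`H₂ ≠ 0`. [cite: AtiyahMacdonald1969, Prop. 3.9 and Ex. 3.7] -/
theorem isDomain_doublePlaneRing [IsDomain R] [IsDomain (DeckRing a)] (hH : planeH₂ a dinv ≠ 0) :
    IsDomain (DoublePlaneRing a) :=
  isDomain_doublePlaneRing_of_mem_nonZeroDivisors a (hBar_mem_nonZeroDivisors a dinv hd hH)

/-- **The deck chart and the double-plane chart are birational over `Spec R`** at such a parameter.
[cite: GortzWedhorn2020, Prop. 4.32 (2)] -/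
theorem birationalOver_spec_doublePlane [IsDomain R] [IsDomain (DeckRing a)] (hH : planeH₂ a dinv ≠ 0) :
    Scheme.BirationalOver (Spec.map (CommRingCat.ofHom (algebraMap R (DeckRing a))))
      (Spec.map (CommRingCat.ofHom (algebraMap R (DoublePlaneRing a)))) :=
  birationalOver_spec_toDeck_of_mem_nonZeroDivisors a (hBar_mem_nonZeroDivisors a dinv hd hH)

end NonZeroDivisor

end Literature.AlgebraicGeometry.HodgeTheory.Q8Family

end
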